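import Literature.NumberTheory.Automorphic.Liu2021.AppendixC.AlbaneseFunctorial
import Literature.NumberTheory.Automorphic.Liu2021.AlbaneseBaseChange
import Literature.AlgebraicGeometry.Motives.VarietiesProperProofs
import HarnessLib

/-!
# Liu 2021 §4.2: the standing datum `Sec42Data` is inhabited, given the Proposition of §2.1 as printed

`AppendixC/Glue.lean` (typer 4) POSITS the standing data of §4.2 (`Sec42Data P5 isotropicAt`: «`n ≥ 2`», the system of
Shimura varieties `S` of Prop. C.5 / Def. C.6, the projectivity clause, the compactified system `cpt` of Def. C.8, the
Albanese data `alb K` of every `X_K` with the transition morphisms `∇u`, `Alb_u` and their printed properties).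
`AppendixC/AlbaneseFunctorial.lean` (b11) constructs the transition fields from `alb` alone (`Sec42Data.ofAlbanese`, with the
rigidity theorem `Sec42Data.eq_ofAlbanese`), and `Liu2021/AlbaneseBaseChange.lean` records the Proposition of §2.1 AS
PRINTED (`Liu2021.exists_albanese`: a proper smooth scheme over a field has an Albanese datum, Def. 2.3).  This file
draws the one-line consequence: **given `exists_albanese`, every `(n ≥ 2, S, projectivity iff, cpt)` extends to a
`Sec42Data`** — `X_K = S̃h(𝕍)_K` being «smooth projective … of dimension `n − 1`» (§4.2 l. 2064: `CompactifiedSystem.smooth_X`,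
`projective_X`; properness by the tree's `IsProjectiveOver.isProper`).  It is the non-vacuity exit BY NAME for the Albanese
part of the Appendix-C carrier (TEAM hComp referee ruling R-2): what remains posited in a consumer's `C : Sec42Data …` is
exactly Prop. C.5's witness `S`, the compactification carriers `cpt`, and the projectivity clause.  Theorem only; no
definition, no named fact, no instance.  HC_CM is NOT proved; nothing here discharges any COR-CM binder.

References: [Liu2021] §2.1 Proposition l. 1190–1200, Def. 2.1 (1), Def. 2.3; §4.2 l. 2053–2070; App. C Def. C.6, Def. C.8.
-/

noncomputable section

open CategoryTheory AlgebraicGeometry NumberField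
open Literature.AlgebraicGeometry.Motives (SchemeOver IsProjectiveOver)

namespace Literature.NumberTheory.Automorphic.Liu2021.AppendixC

variable {F E : Type} [Field F] [NumberField F] [IsTotallyReal F] [Field E] [NumberField E] [Algebra F E]
  [IsTotallyComplex E] [Algebra.IsQuadraticExtension F E]

/-- **`Sec42Data` from the Proposition of §2.1.**  Given the Proposition of [Liu2021] §2.1 as printed (`exists_albanese`:
every proper smooth scheme over a field has an Albanese datum `Albanese X`, Def. 2.3), «`n ≥ 2`» (l. 2053), a system `S` of
Shimura varieties associated to `𝕍` (Prop. C.5 / Def. C.6), the printed projectivity clause (l. 2060) and the compactified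
system `cpt` (Def. C.8, with `X_K` «smooth projective … of dimension `n − 1`», l. 2064), the standing data of §4.2 exist:
`Sec42Data.ofAlbanese` (`AppendixC/AlbaneseFunctorial.lean`) at the Albanese data chosen from `exists_albanese` for the
proper (`IsProjectiveOver.isProper`) smooth (`SmoothOfRelativeDimension.smooth`) `E`-schemes `X_K`.  Ours (assembly).
[cite: Liu2021, §4.2 FJcycle.tex l. 2053–2070, §2.1 Proposition l. 1190–1192, Def. 2.3 l. 1202–1208] -/
theorem Sec42Data.nonempty_of_exists_albanese (hA : exists_albanese) {P5 : PropC5Data F E} (isotropicAt : ℕ → Prop)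
    (two_le_n : 2 ≤ P5.n) (S : IncoherentShimuraSystem P5)
    (hproj : ∀ K, IsProjectiveOver (S.Sh𝕍.obj K) ↔
      ¬ (Module.finrank ℚ F = 1 ∧ (3 ≤ P5.n ∨ (P5.n = 2 ∧ ∀ p : ℕ, p.Prime → isotropicAt p))))
    (cpt : CompactifiedSystem S) : Nonempty (Sec42Data P5 isotropicAt) :=
  ⟨Sec42Data.ofAlbanese two_le_n S hproj cpt fun K =>
    haveI := cpt.smooth_X K
    (hA E (cpt.X.obj K) (cpt.projective_X K).isProper (SmoothOfRelativeDimension.smooth (P5.n - 1) _)).some⟩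

end Literature.NumberTheory.Automorphic.Liu2021.AppendixC

end
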